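import Literature.NumberTheory.EllipticCurves.ZpExtensionEisensteinPiLevelH2BoundProofs
import Literature.NumberTheory.EllipticCurves.ZpExtensionEisensteinSelmerStructureProofs
import Literature.Algebra.Module.EigenvectorAnnihilatorCountProofs
import HarnessLib

/-!
# `#H²(K_w, Fil_w W_k) ≤ p^{p^s}`: the uniform `H²`-bound on the twisted plus line of Howard's `p`-adic Eisenstein levels
# (theorems only — no definition, no named fact, no instance, no `sorry`)

Topic `NumberTheory/EllipticCurves` (cell `pub/bsd-print-x9`, shared μ-crux stmt-BirchSwinnertonDyer-23428, STUB B clause (B5)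
`Stmt.readoutIndex`, the «Fil half» of the local index at `v ∣ p`; `p`-adic twin of x10b-p1-w5's `π`-adic
`WeierstrassCurve.natCard_two_piFil_le` (`ZpExtensionEisensteinPiLevelH2BoundProofs`)).

For the Eisenstein level `W_k = M_k ⊗ A_{m,k}(ψ)` of a tower `(M_k, t_k)` with an ordinary datum `Φ` at `w` (`Fil_w W_k = A_{m,k} ⊗ Fil_w M_k`,
`OrdinaryFiltration.twistedFil`) whose plus part `Fil_w M_k` is CYCLIC on `P₀` with `g₀ ∈ Γ_{K_w}` acting by the integer `λ`, `κ(g₀) = p^s`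
(`p^s < m`) and `g₀` acting on `μ_{p^k}` by an integer `c` prime to `p`:

* **`ZpExtension.OrdinaryFiltration.natCard_two_twistedFil_le`** — `H²(K_w, Fil_w W_k)` (the subrepresentation of `W_k|_{Γ_{K_w}}` on
  `Fil_w W_k`) is finite of order `≤ p^{p^s}`, uniformly in `k ≥ 1` and `m`: `Fil_w W_k` is the cyclic `A_{m,k}`-line through `1 ⊗ P₀` on
  which `g₀` acts by `μ = λ(1+T)^{p^s}`; the scalar dichotomy `(μ − c)·ν = [T]^{p^s}` (`IwasawaAlgebraEisensteinScalarDichotomyProofs`) and the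
  one-element count `natCard_two_le_natCard_quotient_of_mu_apply_eq_smul` give `#H² ≤ #(Fil ⧸ [T]^{p^s} Fil) ≤ #(A_{m,k} ⧸ [T]^{p^s}) ≤
  #(S_𝔮 ⧸ (T^{p^s})) = p^{p^s}`.

This is the bound `B` of `Tower.natCard_range_quotient_levelCondition_le` (`TowerCoreLiftableIndexProofs`) for the Fil sub-tower: the
part of the strict ordinary core not in the saturated condition `F_𝔮(w)` has order `≤ p^{p^s}` (the companion file assembles it).
No summit statement is proved; BSD is not proved by any of this.

References: [Howard2004HeegnerKolyvagin] Lemma 3.2.7 (arXiv:1202.6340 p. 16 L150–156: «controlled by H²(K_v, Fil_v 𝐓)[𝔭]»), §3.1,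
proof of Thm. 2.2.10 (`𝔮 = T^m + p`); [MilneADT2006] I Cor. 2.3; [GreenbergLNM1716] §2 and proof of Prop. 4.15; [Washington1997] §13.2.
-/

set_option autoImplicit false

noncomputable section

open Function NumberField IsDedekindDomain Field
open scoped NumberField ContRepresentation

namespace Literature.NumberTheory.EllipticCurves

namespace ZpExtension

open Literature.NumberTheory.GaloisRepresentations IwasawaAlgebra IwasawaAlgebra.EisensteinCoeff
open Literature.NumberTheory.GaloisRepresentations.DiscreteGaloisModule

variable {K : Type} [Field K] [NumberField K] {p : ℕ} [hp : Fact p.Prime] (κ : ZpExtension K p)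
  {M : ℕ → Type} [∀ k, AddCommGroup (M k)] [∀ k, TopologicalSpace (M k)] [∀ k, DiscreteTopology (M k)]
  {ρ : ∀ k, DiscreteGaloisModule K (M k)}
  {t : ∀ k, (ρ (k + 1)).toContRepresentation →ⁱL (ρ k).toContRepresentation} {m : ℕ} (hm : 1 ≤ m)
  {w : HeightOneSpectrum (𝓞 K)} (Φ : OrdinaryFiltration ρ t w)

/-- **`#H²(K_w, Fil_w W_k) ≤ p^{p^s}`, uniformly in the level `k ≥ 1` and in `m`.**  For the plus part `Fil_w M_k` cyclic on `P₀`,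
`g₀ ∈ Γ_{K_w}` with `κ(g₀) = p^s` (`p^s < m`) acting on `P₀` by the integer `λ` and on `μ_{p^k}` by the integer `c`, `p ∤ c`: the
subrepresentation of `W_k|_{Γ_{K_w}}` on `Fil_w W_k = A_{m,k} ⊗ Fil_w M_k` has `H²` finite of order `≤ p^{p^s}`.
[cite: Howard2004HeegnerKolyvagin, Lemma 3.2.7 (arXiv:1202.6340 p. 16 L150–156) and §3.1] [cite: MilneADT2006, Ch. I Cor. 2.3]
[cite: GreenbergLNM1716, §2 and proof of Prop. 4.15] -/
theorem OrdinaryFiltration.natCard_two_twistedFil_le (k : ℕ) [Finite (M k)] (hk : 1 ≤ k)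
    (P₀ : M k) (hP₀ : P₀ ∈ Φ.fil k) (hgen : ∀ a ∈ Φ.fil k, ∃ n : ℤ, n • P₀ = a)
    {g₀ : absoluteGaloisGroup (w.adicCompletion K)} {s : ℕ}
    (hg₀ : (κ (absGaloisRestrict K (w.adicCompletion K) g₀)).toAdd = ((p ^ s : ℕ) : ℤ_[p])) (hms : p ^ s < m)
    (lam : ℤ) (hlam : ρ k (absGaloisRestrict K (w.adicCompletion K) g₀) P₀ = lam • P₀)
    (c : ℤ) (hc : ∀ ζ : MuCarrier (w.adicCompletion K) (p ^ k), mu (w.adicCompletion K) (p ^ k) g₀ ζ = c • ζ)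
    (hcp : ¬ (p : ℤ) ∣ c) :
    Finite (continuousCohomology 2 ((GaloisRep.toLocal w (κ.eisensteinTwist (ρ k) hm k)).subrepresentation (Φ.twistedFil k)
        (Φ.twistedFil_le_comap hm k)).toTopRep) ∧
      Nat.card (continuousCohomology 2 ((GaloisRep.toLocal w (κ.eisensteinTwist (ρ k) hm k)).subrepresentation (Φ.twistedFil k)
        (Φ.twistedFil_le_comap hm k)).toTopRep) ≤ p ^ (p ^ s) := by
  classical
  haveI : CharZero (w.adicCompletion K) := charZero_of_injective_algebraMap (algebraMap K _).injective
  haveI hfinW : Finite (EisensteinCoeff.Twisted p m k (M k)) := EisensteinCoeff.finite_twisted (p := p) (k := k) hm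
  -- ### abbreviations: `A = A_{m,k}`, the generator `t₀ = 1 ⊗ P₀` of the line `Fil_w W_k`
  let A := EisensteinCoeff p m k
  haveI : Finite A := finite_quotient_span_qm_sup_span_C_pow p hm k
  let t₀ : EisensteinCoeff.Twisted p m k (M k) := EisensteinCoeff.Twisted.tmul (1 : A) P₀
  have ht₀ : t₀ ∈ Φ.twistedFil (p := p) (m := m) k := Φ.tmul_mem_twistedFil k 1 hP₀
  -- every element of `Fil_w W_k` is an `A`-multiple of `1 ⊗ P₀`
  have hline : ∀ z : EisensteinCoeff.Twisted p m k (M k), z ∈ Φ.twistedFil (p := p) (m := m) k →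
      ∃ a : A, a • t₀ = z := by
    intro z hz
    induction hz using Submodule.span_induction with
    | mem x hx =>
      obtain ⟨c', a, ha, rfl⟩ := hx
      obtain ⟨n, rfl⟩ := hgen a ha
      refine ⟨n • c', ?_⟩
      rw [← Twisted.zsmul_tmul n c' P₀, Twisted.tmul_eq_smul_tmul_one (n • c') P₀]
    | zero => exact ⟨0, zero_smul _ _⟩
    | add x y _ _ hx hy =>
      obtain ⟨a, rfl⟩ := hx
      obtain ⟨b, rfl⟩ := hy
      exact ⟨a + b, add_smul a b _⟩
    | smul n x _ hx =>
      obtain ⟨a, rfl⟩ := hx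
      exact ⟨n • a, smul_assoc n a _⟩
  -- ### the exponent of `g₀` at level `k` is `p^s`; the scalars `μ`, `ν`
  have he : κ.twistExponent (eisensteinLevel (p := p) hm k) (absGaloisRestrict K (w.adicCompletion K) g₀) = p ^ s :=
    twistExponent_eq_of_toAdd_eq_natCast_pow κ (pow_lt_pow_eisensteinLevel hm hk hms) hg₀
  let μA : A := (lam : A) * onePlusT p m k ^ (p ^ s)
  obtain ⟨νA, hνA⟩ := exists_intCast_mul_onePlusT_pow_sub_intCast_mul_eq_mk_X_pow p k s hms lam c hcp
  let πA : A := Ideal.Quotient.mk _ PowerSeries.X ^ (p ^ s)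
  have hθν : ∀ y : EisensteinCoeff.Twisted p m k (M k), ((μA - (c : A)) * νA) • y = πA • y := by
    intro y
    rw [hνA]
  -- ### the action of `g₀` on the generator: `g₀ · (1 ⊗ P₀) = μ • (1 ⊗ P₀)`
  have hρt₀ : κ.eisensteinTwist (ρ k) hm k (absGaloisRestrict K (w.adicCompletion K) g₀) t₀ = μA • t₀ := by
    change κ.eisensteinTwist (ρ k) hm k (absGaloisRestrict K (w.adicCompletion K) g₀)
        (EisensteinCoeff.Twisted.tmul (1 : A) P₀) =
      ((lam : A) * onePlusT p m k ^ (p ^ s)) • EisensteinCoeff.Twisted.tmul (1 : A) P₀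
    rw [κ.eisensteinTwist_apply_tmul, he, mul_one, hlam, ← Twisted.zsmul_tmul, Twisted.smul_tmul, mul_one, zsmul_eq_mul]
  have hlin : ∀ (a : A) (y : EisensteinCoeff.Twisted p m k (M k)),
      κ.eisensteinTwist (ρ k) hm k (absGaloisRestrict K (w.adicCompletion K) g₀) (a • y) =
        a • κ.eisensteinTwist (ρ k) hm k (absGaloisRestrict K (w.adicCompletion K) g₀) y :=
    fun a y ↦ κ.eisensteinTwist_apply_smul (ρ k) hm k _ a y
  -- ### the subrepresentation `X = Fil_w W_k`, killed by `p^k`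
  have hM : ∀ x : Φ.twistedFil (p := p) (m := m) k, p ^ k • x = 0 := by
    intro x
    apply Subtype.ext
    rw [Submodule.coe_smul_of_tower, Submodule.coe_zero]
    exact EisensteinCoeff.prime_pow_nsmul_twisted (p := p) (m := m) (x : EisensteinCoeff.Twisted p m k (M k))
  -- ### the coordinate map `q : A → Fil_w W_k`, `a ↦ a • t₀`, onto
  let q : A →+ Φ.twistedFil (p := p) (m := m) k :=
    AddMonoidHom.mk' (fun a ↦ ⟨a • t₀, Φ.smul_mem_twistedFil k a ht₀⟩) (fun a b ↦ Subtype.ext (add_smul a b t₀))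
  have hq : ∀ a : A, ((q a : Φ.twistedFil (p := p) (m := m) k) : EisensteinCoeff.Twisted p m k (M k)) = a • t₀ :=
    fun _ ↦ rfl
  have hqsurj : Surjective q := by
    intro x
    obtain ⟨a, ha⟩ := hline _ x.2
    exact ⟨a, Subtype.ext (by rw [hq, ha])⟩
  -- ### `R = [T]^{p^s} · Fil_w W_k` and the eigen identity `g₀ v − c v = r`
  let I : Ideal A := Ideal.span {πA}
  let R : AddSubgroup (Φ.twistedFil (p := p) (m := m) k) := I.toAddSubgroup.map q
  have hR : ∀ r ∈ R, ∃ v : Φ.twistedFil (p := p) (m := m) k,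
      (GaloisRep.toLocal w (κ.eisensteinTwist (ρ k) hm k)).subrepresentation (Φ.twistedFil k) (Φ.twistedFil_le_comap hm k)
        g₀ v - c • v = r := by
    rintro _ ⟨a, ha, rfl⟩
    obtain ⟨b, rfl⟩ := Ideal.mem_span_singleton'.mp ha
    refine ⟨q (b * νA), Subtype.ext ?_⟩
    rw [Submodule.coe_sub, Submodule.coe_smul_of_tower, ContinuousRep.subrepresentation_apply_coe, hq, hq,
      GaloisRep.toLocal_apply, hlin, hρt₀]
    calc (b * νA) • μA • t₀ - c • (b * νA) • t₀
        = (b * νA * μA) • t₀ - ((c : A) * (b * νA)) • t₀ := by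
          rw [mul_smul (b * νA) μA t₀, mul_smul (c : A) (b * νA) t₀, Int.cast_smul_eq_zsmul]
      _ = (b * ((μA - (c : A)) * νA)) • t₀ :=
          (sub_smul (b * νA * μA) ((c : A) * (b * νA)) t₀).symm.trans (congrArg (· • t₀) (by ring))
      _ = (b * πA) • t₀ := (mul_smul b _ t₀).trans ((congrArg (b • ·) (hθν t₀)).trans (mul_smul b _ t₀).symm)
  -- ### local duality + the count
  obtain ⟨hfin, hle⟩ := natCard_two_le_natCard_quotient_of_mu_apply_eq_smul (w.adicCompletion K)
    ((GaloisRep.toLocal w (κ.eisensteinTwist (ρ k) hm k)).subrepresentation (Φ.twistedFil k)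
      (Φ.twistedFil_le_comap hm k)) hM g₀ c hc R hR
  refine ⟨hfin, hle.trans ?_⟩
  -- `#(Fil ⧸ R) ≤ #(A ⧸ I) ≤ #(S_𝔮 ⧸ (T^{p^s})) = p^{p^s}`
  have hfinI : Finite (A ⧸ I.toAddSubgroup) := Finite.of_surjective _ (QuotientAddGroup.mk_surjective)
  let qbar : A ⧸ I.toAddSubgroup →+ (Φ.twistedFil (p := p) (m := m) k) ⧸ R :=
    QuotientAddGroup.map _ R q (fun a ha ↦ AddSubgroup.mem_map_of_mem q ha)
  have hqbar : Surjective qbar := by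
    intro y
    induction y using QuotientAddGroup.induction_on with
    | H x =>
      obtain ⟨a, rfl⟩ := hqsurj x
      exact ⟨QuotientAddGroup.mk a, by rw [QuotientAddGroup.map_mk]⟩
  haveI : Finite ((IwasawaAlgebra p ⧸ Ideal.span {(PowerSeries.X ^ m + PowerSeries.C (p : ℤ_[p]) : IwasawaAlgebra p)}) ⧸
      Ideal.span {Ideal.Quotient.mk (Ideal.span {(PowerSeries.X ^ m + PowerSeries.C (p : ℤ_[p]) : IwasawaAlgebra p)})
        (PowerSeries.X ^ (p ^ s))}) :=
    Nat.finite_of_card_ne_zero (by rw [natCard_quotient_span_mk_X_pow_eq p hms]; exact pow_ne_zero _ hp.out.ne_zero)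
  have hπA : πA = ofSpec p m k (Ideal.Quotient.mk _ (PowerSeries.X ^ (p ^ s))) := by
    rw [ofSpec_mk, map_pow]
  calc Nat.card (↥(Φ.twistedFil (p := p) (m := m) k) ⧸ R) ≤ Nat.card (A ⧸ I.toAddSubgroup) := Nat.card_le_card_of_surjective qbar hqbar
    _ = Nat.card (A ⧸ I) := rfl
    _ ≤ Nat.card ((IwasawaAlgebra p ⧸ Ideal.span {(PowerSeries.X ^ m + PowerSeries.C (p : ℤ_[p]) : IwasawaAlgebra p)}) ⧸
          Ideal.span {Ideal.Quotient.mk (Ideal.span {(PowerSeries.X ^ m + PowerSeries.C (p : ℤ_[p]) : IwasawaAlgebra p)})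
            (PowerSeries.X ^ (p ^ s))}) := by
        change Nat.card (A ⧸ Ideal.span {πA}) ≤ _
        rw [hπA]
        exact Literature.Algebra.Module.natCard_quotient_span_map_le _ (ofSpec_surjective (p := p) m k) _
    _ = p ^ (p ^ s) := natCard_quotient_span_mk_X_pow_eq p hms

end ZpExtension

end Literature.NumberTheory.EllipticCurves
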